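import Literature.Analysis.FluidPDE.ElgindiRadialModeRegularity
import Literature.Analysis.FluidPDE.ElgindiAngularMomentDensity
import Literature.Analysis.FluidPDE.ElgindiWeightedSpaces
import Mathlib.MeasureTheory.Integral.Prod
import HarnessLib

/-!
# Uniqueness of finite-energy very weak solutions of Elgindi's polar elliptic problem
([Elgindi2021] §7.1, Proposition 7.1: "the unique `L²` solution")

Topic `Literature/Analysis/FluidPDE`. Proof file (everything proved, no definitions, no named
facts) on the proof path of the named fact
`Literature.Analysis.FluidPDE.Elgindi.ElgindiGhoulMasmoudi2021_stabilityCore`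
(`ElgindiStabilityDecomposition.lean`). T. M. Elgindi, Ann. of Math. 194 (2021) =
arXiv:1904.04795, §7.1 Proposition 7.1 (p. 19 of the held text): "the unique `L²` solution to
(PolarBSL) with Dirichlet boundary conditions".

`ae_eq_zero_of_veryWeak_modes`: if `D ∈ L²(strip)` is measurable and annihilates the separated
profiles `P(a(R)cos^qθ sinʲθ)` of a polar operator `P` with radial part `−α²R²∂_RR + βR∂_R` and
angular part acting triangularly on the monomials (`L`: `q = 1`, `β = −α(5+α)`, shift `σ = −6`;
its transpose `ᵗL`: `q = 2`, `β = 5α − 3α²`, `σ = 5α − α² − 6`) — e.g. `L(a(R)cos θ sinʲθ)` (`j` odd, `a` any test function of `(0,∞)`; by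
`ElgindiAngularMonomialModes.lean` these are `(Euler a)·m_j + a[((j+1)(j+2)−6)m_j − j(j−1)m_{j−2}]`),
then `D = 0` a.e. on the strip. Proof: the radial moments `d_j(R) = ∫ D(R,θ)cos θ sinʲθ dθ` are
`L²((0,∞))` very weak solutions of a triangular system of Euler equations, hence vanish one after
the other (`radialMode_ae_eq_zero`); then for a.e. `R` all odd trigonometric moments of `D(R,·)`
vanish, so `D(R,·) = 0` a.e. (`ae_eq_zero_of_forall_oddMoment_eq_zero`). This is the uniqueness
half of Proposition 7.1 in the class of square-integrable very weak solutions tested against the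
profiles `cos θ·χ(R,θ)` (no boundary regularity of the solution is needed).
-/

noncomputable section

open MeasureTheory Set Real Filter Function
open _root_.Topology
open scoped ContDiff ENNReal

namespace Literature.Analysis.FluidPDE

namespace Elgindi

/-! ### Integrability of `D·b(R)·m(θ)` on the strip and Fubini -/

section slices

variable {D : ℝ × ℝ → ℝ} (hDm : StronglyMeasurable D) (hD2 : IntegrableOn (fun p => D p ^ 2) strip)
include hDm hD2

/-- `D ∈ L²` is integrable on the part of the strip over a compact radial range. [folklore] -/
theorem integrableOn_of_sq_compact {K : Set ℝ} (hK : IsCompact K) : IntegrableOn D (strip ∩ K ×ˢ univ) := by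
  have hfin : volume (strip ∩ K ×ˢ (univ : Set ℝ)) < (⊤ : ℝ≥0∞) := by
    have hsub : strip ∩ K ×ˢ (univ : Set ℝ) ⊆ K ×ˢ Icc 0 (π / 2) := by
      rintro ⟨R, θ⟩ ⟨⟨_, hθ⟩, hK', -⟩
      exact ⟨hK', Ioo_subset_Icc_self hθ⟩
    exact (measure_mono hsub).trans_lt ((hK.prod isCompact_Icc).measure_lt_top)
  have hmeas : MeasurableSet (strip ∩ K ×ˢ (univ : Set ℝ)) := measurableSet_strip.inter (hK.measurableSet.prod MeasurableSet.univ)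
  haveI : IsFiniteMeasure (volume.restrict (strip ∩ K ×ˢ (univ : Set ℝ))) := isFiniteMeasure_restrict.2 hfin.ne
  have h2 : MemLp D 2 (volume.restrict (strip ∩ K ×ˢ (univ : Set ℝ))) := by
    rw [memLp_two_iff_integrable_sq hDm.aestronglyMeasurable]
    exact hD2.mono_set inter_subset_left
  exact h2.integrable one_le_two

/-- `D·b(R)·m(θ)` is integrable on the strip for `b` bounded, measurable, supported in a compact
subset of `(0,∞)`, and `m` measurable with `|m| ≤ 1`. [folklore] -/
theorem integrableOn_mul_sep {b m : ℝ → ℝ} (hb : Measurable b) (hm : Measurable m) {K : Set ℝ} (hK : IsCompact K)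
    (hbK : ∀ R, R ∉ K → b R = 0) {C : ℝ} (hbC : ∀ R, |b R| ≤ C) (hm1 : ∀ θ, |m θ| ≤ 1) :
    IntegrableOn (fun p : ℝ × ℝ => D p * (b p.1 * m p.2)) strip := by
  have h1 : IntegrableOn (fun p : ℝ × ℝ => D p * (b p.1 * m p.2)) (strip ∩ K ×ˢ univ) := by
    have hD := integrableOn_of_sq_compact hDm hD2 hK
    have hmeas : AEStronglyMeasurable (fun p : ℝ × ℝ => b p.1 * m p.2) (volume.restrict (strip ∩ K ×ˢ univ)) :=
      ((hb.comp measurable_fst).mul (hm.comp measurable_snd)).aestronglyMeasurable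
    have := hD.bdd_mul (c := |C| * 1) hmeas
      (ae_of_all _ fun p => by
        rw [Real.norm_eq_abs, abs_mul]
        exact mul_le_mul ((hbC p.1).trans (le_abs_self C)) (hm1 p.2) (abs_nonneg _) (abs_nonneg _))
    exact this.congr (ae_of_all _ fun p => by simp only []; ring)
  refine h1.of_forall_sdiff_eq_zero measurableSet_strip fun p hp => ?_
  have : p.1 ∉ K := fun h => hp.2 ⟨hp.1, h, mem_univ _⟩
  rw [hbK p.1 this]; ring

/-- **Fubini for separated multipliers**: `∫∫_strip D·b(R)m(θ) = ∫_{R>0} b(R)·(∫_{(0,π/2)} D(R,θ)m(θ)dθ) dR`. [folklore] -/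
theorem integral_strip_mul_sep {b m : ℝ → ℝ} (hb : Measurable b) (hm : Measurable m) {K : Set ℝ} (hK : IsCompact K)
    (hbK : ∀ R, R ∉ K → b R = 0) {C : ℝ} (hbC : ∀ R, |b R| ≤ C) (hm1 : ∀ θ, |m θ| ≤ 1) :
    ∫ p in strip, D p * (b p.1 * m p.2) = ∫ R in Ioi (0:ℝ), b R * ∫ θ in Ioo 0 (π / 2), D (R, θ) * m θ := by
  have hi := integrableOn_mul_sep hDm hD2 hb hm hK hbK hbC hm1
  have h : IntegrableOn (fun p : ℝ × ℝ => D p * (b p.1 * m p.2)) (Ioi (0:ℝ) ×ˢ Ioo 0 (π / 2)) ((volume : Measure ℝ).prod volume) := by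
    rw [← Measure.volume_eq_prod]; exact hi
  have := setIntegral_prod (fun p : ℝ × ℝ => D p * (b p.1 * m p.2)) h
  rw [← Measure.volume_eq_prod] at this
  rw [show (strip : Set (ℝ × ℝ)) = Ioi (0:ℝ) ×ˢ Ioo 0 (π / 2) from rfl, this]
  refine setIntegral_congr_fun measurableSet_Ioi fun R _ => ?_
  rw [← MeasureTheory.integral_const_mul]
  exact setIntegral_congr_fun measurableSet_Ioo fun θ _ => by ring

end slices

/-! ### The radial moments `d_j(R) = ∫ D(R,θ) cos θ sinʲθ dθ` -/

/-- `|cos^qθ sinʲθ| ≤ 1`. [folklore] -/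
theorem abs_monomial_le_one (q j : ℕ) (θ : ℝ) : |Real.cos θ ^ q * Real.sin θ ^ j| ≤ 1 := by
  rw [abs_mul, abs_pow, abs_pow]
  exact mul_le_one₀ (pow_le_one₀ (abs_nonneg _) (Real.abs_cos_le_one θ)) (pow_nonneg (abs_nonneg _) _)
    (pow_le_one₀ (abs_nonneg _) (Real.abs_sin_le_one θ))

/-- The angular monomials are measurable. [folklore] -/
theorem measurable_monomial (q j : ℕ) : Measurable fun θ : ℝ => Real.cos θ ^ q * Real.sin θ ^ j := by fun_prop

/-- The strip measure as a product of restricted measures. [folklore] -/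
theorem volume_restrict_strip_eq_prod :
    (volume.restrict strip : Measure (ℝ × ℝ)) = ((volume : Measure ℝ).restrict (Ioi 0)).prod (volume.restrict (Ioo 0 (π / 2))) := by
  rw [Measure.prod_restrict, ← Measure.volume_eq_prod]; rfl

section moments2

variable {D : ℝ × ℝ → ℝ} (hDm : StronglyMeasurable D) (hD2 : IntegrableOn (fun p => D p ^ 2) strip) (q : ℕ)
include hDm hD2

/-- **The radial moments are locally integrable on `(0,∞)`.** [folklore] -/
theorem locallyIntegrableOn_moment (j : ℕ) :
    LocallyIntegrableOn (fun R => ∫ θ in Ioo 0 (π / 2), D (R, θ) * (Real.cos θ ^ q * Real.sin θ ^ j)) (Ioi 0) volume := by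
  rw [locallyIntegrableOn_iff isOpen_Ioi.isLocallyClosed]
  intro K hK hKc
  classical
  set b : ℝ → ℝ := K.indicator fun _ => (1:ℝ) with hb
  have hbm : Measurable b := measurable_const.indicator hKc.measurableSet
  have hbK : ∀ R, R ∉ K → b R = 0 := fun R hR => by simp [hb, hR]
  have hbC : ∀ R, |b R| ≤ 1 := fun R => by by_cases h : R ∈ K <;> simp [hb, h]
  have hi := integrableOn_mul_sep hDm hD2 hbm (measurable_monomial q j) hKc hbK hbC (abs_monomial_le_one q j)
  have hi' : Integrable (fun p : ℝ × ℝ => D p * (b p.1 * (Real.cos p.2 ^ q * Real.sin p.2 ^ j)))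
      (((volume : Measure ℝ).restrict (Ioi 0)).prod (volume.restrict (Ioo 0 (π / 2)))) := by
    rw [← volume_restrict_strip_eq_prod]; exact hi
  have h1 := hi'.integral_prod_left
  -- the inner integral is `b(R)·d_j(R)`
  have e : (fun R => ∫ θ, D (R, θ) * (b (R, θ).1 * (Real.cos (R, θ).2 ^ q * Real.sin (R, θ).2 ^ j)) ∂(volume.restrict (Ioo 0 (π / 2)))) =
      fun R => b R * ∫ θ in Ioo 0 (π / 2), D (R, θ) * (Real.cos θ ^ q * Real.sin θ ^ j) := by
    funext R
    rw [← MeasureTheory.integral_const_mul]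
    exact integral_congr_ae (ae_of_all _ fun θ => by simp only []; ring)
  rw [e] at h1
  have h2 : IntegrableOn (fun R => b R * ∫ θ in Ioo 0 (π / 2), D (R, θ) * (Real.cos θ ^ q * Real.sin θ ^ j)) K volume :=
    (h1.mono_measure (Measure.restrict_mono hK le_rfl))
  refine h2.congr_fun (fun R hR => ?_) hKc.measurableSet
  simp [hb, hR]

omit hD2 in
/-- The radial moments are a.e. strongly measurable on `(0,∞)`. [folklore] -/
theorem aestronglyMeasurable_moment (j : ℕ) :
    AEStronglyMeasurable (fun R => ∫ θ in Ioo 0 (π / 2), D (R, θ) * (Real.cos θ ^ q * Real.sin θ ^ j)) (volume.restrict (Ioi 0)) := by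
  have hm : AEStronglyMeasurable (fun p : ℝ × ℝ => D p * (Real.cos p.2 ^ q * Real.sin p.2 ^ j))
      (((volume : Measure ℝ).restrict (Ioi 0)).prod (volume.restrict (Ioo 0 (π / 2)))) :=
    (hDm.measurable.mul ((measurable_monomial q j).comp measurable_snd)).aestronglyMeasurable
  exact hm.integral_prod_right'

/-- **The radial moments are square integrable on `(0,∞)`**: `d_j(R)² ≤ (π/2)∫ D(R,θ)² dθ`. [folklore] -/
theorem integrableOn_sq_moment (j : ℕ) :
    IntegrableOn (fun R => (∫ θ in Ioo 0 (π / 2), D (R, θ) * (Real.cos θ ^ q * Real.sin θ ^ j)) ^ 2) (Ioi 0) volume := by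
  -- the slice energy `E(R) = ∫ D(R,θ)² dθ` is integrable on `(0,∞)`
  have hD2' : Integrable (fun p : ℝ × ℝ => D p ^ 2) (((volume : Measure ℝ).restrict (Ioi 0)).prod (volume.restrict (Ioo 0 (π / 2)))) := by
    rw [← volume_restrict_strip_eq_prod]; exact hD2
  have hE := hD2'.integral_prod_left
  have hslice := hD2'.prod_right_ae
  -- pointwise bound for a.e. `R`
  haveI hfinI : IsFiniteMeasure (volume.restrict (Ioo (0:ℝ) (π / 2))) := by
    refine isFiniteMeasure_restrict.2 ?_
    simp [Real.volume_Ioo]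
  have hvol : (volume.restrict (Ioo (0:ℝ) (π / 2))) univ = ENNReal.ofReal (π / 2) := by
    rw [Measure.restrict_apply_univ, Real.volume_Ioo, sub_zero]
  have hbound : ∀ᵐ R ∂(volume.restrict (Ioi (0:ℝ))),
      ‖(∫ θ in Ioo 0 (π / 2), D (R, θ) * (Real.cos θ ^ q * Real.sin θ ^ j)) ^ 2‖ ≤ (π / 2) * ∫ θ in Ioo 0 (π / 2), D (R, θ) ^ 2 := by
    filter_upwards [hslice] with R hR
    rw [Real.norm_eq_abs, abs_of_nonneg (sq_nonneg _)]
    have hmeasR : AEStronglyMeasurable (fun θ => D (R, θ)) (volume.restrict (Ioo 0 (π / 2))) :=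
      (hDm.measurable.comp (measurable_const.prodMk measurable_id)).aestronglyMeasurable
    have hL2R : MemLp (fun θ => D (R, θ)) 2 (volume.restrict (Ioo 0 (π / 2))) := (memLp_two_iff_integrable_sq hmeasR).2 hR
    have hint : Integrable (fun θ => D (R, θ)) (volume.restrict (Ioo 0 (π / 2))) := hL2R.integrable one_le_two
    have hL2 : MemLp (fun θ => |D (R, θ)|) (ENNReal.ofReal 2) (volume.restrict (Ioo 0 (π / 2))) := by
      rw [show ENNReal.ofReal 2 = 2 by norm_num]; exact hL2R.abs
    have h1 : MemLp (fun _ : ℝ => (1:ℝ)) (ENNReal.ofReal 2) (volume.restrict (Ioo 0 (π / 2))) := memLp_const 1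
    have hH := integral_mul_le_Lp_mul_Lq_of_nonneg Real.HolderConjugate.two_two (ae_of_all _ fun θ => abs_nonneg (D (R, θ)))
      (ae_of_all _ fun _ => zero_le_one) hL2 h1
    -- `|d_j| ≤ ∫|D|·1`
    have habs : |∫ θ in Ioo 0 (π / 2), D (R, θ) * (Real.cos θ ^ q * Real.sin θ ^ j)| ≤ ∫ θ in Ioo 0 (π / 2), |D (R, θ)| * 1 := by
      refine abs_integral_le_integral_abs.trans (integral_mono_of_nonneg (ae_of_all _ fun θ => abs_nonneg _)
        (by simpa using hint.abs) (ae_of_all _ fun θ => ?_))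
      show |D (R, θ) * (Real.cos θ ^ q * Real.sin θ ^ j)| ≤ |D (R, θ)| * 1
      rw [abs_mul]
      exact mul_le_mul_of_nonneg_left (abs_monomial_le_one q j θ) (abs_nonneg _)
    -- evaluate the right-hand side of Hölder
    have eA : ∫ θ in Ioo 0 (π / 2), |D (R, θ)| ^ (2:ℝ) = ∫ θ in Ioo 0 (π / 2), D (R, θ) ^ 2 :=
      integral_congr_ae (ae_of_all _ fun θ => by simp only []; rw [Real.rpow_two, sq_abs])
    have eB : ∫ θ in Ioo 0 (π / 2), (1:ℝ) ^ (2:ℝ) = π / 2 := by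
      simp only [Real.one_rpow, integral_const, smul_eq_mul, mul_one, Measure.real, hvol]
      rw [ENNReal.toReal_ofReal (by positivity)]
    rw [eA, eB] at hH
    have hA0 : 0 ≤ ∫ θ in Ioo 0 (π / 2), D (R, θ) ^ 2 := integral_nonneg fun θ => sq_nonneg _
    set A := ∫ θ in Ioo 0 (π / 2), D (R, θ) ^ 2
    set I := ∫ θ in Ioo 0 (π / 2), |D (R, θ)| * 1
    have hI0 : 0 ≤ I := integral_nonneg fun θ => by positivity
    -- `d² ≤ I² ≤ (A^{1/2}(π/2)^{1/2})² = (π/2)A`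
    have hsq : (A ^ (1 / (2:ℝ)) * (π / 2) ^ (1 / (2:ℝ))) ^ 2 = (π / 2) * A := by
      rw [mul_pow, ← Real.sqrt_eq_rpow, ← Real.sqrt_eq_rpow, Real.sq_sqrt hA0, Real.sq_sqrt (by positivity)]; ring
    calc (∫ θ in Ioo 0 (π / 2), D (R, θ) * (Real.cos θ ^ q * Real.sin θ ^ j)) ^ 2
        ≤ I ^ 2 := by
          have := habs
          rw [← sq_abs]
          exact pow_le_pow_left₀ (abs_nonneg _) this 2
      _ ≤ (A ^ (1 / (2:ℝ)) * (π / 2) ^ (1 / (2:ℝ))) ^ 2 := pow_le_pow_left₀ hI0 hH 2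
      _ = (π / 2) * A := hsq
  exact Integrable.mono' (hE.const_mul (π / 2)) ((aestronglyMeasurable_moment hDm q j).pow 2) hbound

/-! ### The radial identities of the odd moments -/

omit hDm hD2 in
/-- A continuous compactly supported function is bounded and vanishes off its support
(packaging for `integrableOn_mul_sep`). [folklore] -/
theorem test_bounds {b : ℝ → ℝ} (hb : Continuous b) (hs : HasCompactSupport b) :
    ∃ C : ℝ, (∀ R, |b R| ≤ C) ∧ ∀ R, R ∉ tsupport b → b R = 0 := by
  obtain ⟨C, hC⟩ := hb.bounded_above_of_compact_support hs
  exact ⟨C, fun R => by simpa [Real.norm_eq_abs] using hC R, fun R hR => image_eq_zero_of_notMem_tsupport hR⟩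

/-- **The radial identity**: testing `D` against `L(a(R)·cos θ sinʲθ)` gives
`∫ d_j·(Euler a + ((j+1)(j+2)−6)a) dR = j(j−1)∫ d_{j−2}·a dR`. [cite: Elgindi2021, §7.1 proof of Proposition 7.1, Step 1 (p. 19 of arXiv:1904.04795)] -/
theorem moment_radial_identity {α β σ : ℝ} (j : ℕ)
    (H : ∀ a : ℝ → ℝ, ContDiff ℝ ∞ a → HasCompactSupport a → tsupport a ⊆ Ioi 0 →
      ∫ p in strip, D p * ((-α ^ 2 * p.1 ^ 2 * deriv (deriv a) p.1 + β * p.1 * deriv a p.1) * (Real.cos p.2 ^ q * Real.sin p.2 ^ j) +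
        a p.1 * ((((j : ℝ) + 1) * ((j : ℝ) + 2) + σ) * (Real.cos p.2 ^ q * Real.sin p.2 ^ j) -
          (j : ℝ) * ((j : ℝ) - 1) * (Real.cos p.2 ^ q * Real.sin p.2 ^ (j - 2)))) = 0)
    {a : ℝ → ℝ} (ha : ContDiff ℝ ∞ a) (has : HasCompactSupport a) (haS : tsupport a ⊆ Ioi 0) :
    ∫ R in Ioi (0:ℝ), (∫ θ in Ioo 0 (π / 2), D (R, θ) * (Real.cos θ ^ q * Real.sin θ ^ j)) *
        (-α ^ 2 * R ^ 2 * deriv (deriv a) R + β * R * deriv a R + (((j : ℝ) + 1) * ((j : ℝ) + 2) + σ) * a R) =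
      (j : ℝ) * ((j : ℝ) - 1) * ∫ R in Ioi (0:ℝ), a R * ∫ θ in Ioo 0 (π / 2), D (R, θ) * (Real.cos θ ^ q * Real.sin θ ^ (j - 2)) := by
  have h := H a ha has haS
  have ha1 : ContDiff ℝ 1 a := contDiff_one_of_infty ha
  have ha2 : ContDiff ℝ 2 a := contDiff_two_of_infty ha
  have ha1' : ContDiff ℝ 1 (deriv a) := by have := ha2.iterate_deriv' 1 1; simpa using this
  have ca : Continuous a := ha.continuous
  have ca' : Continuous (deriv a) := ha1'.continuous
  have ca'' : Continuous (deriv (deriv a)) := ha1'.continuous_deriv le_rfl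
  -- the two radial multipliers
  set b₁ : ℝ → ℝ := fun R => -α ^ 2 * R ^ 2 * deriv (deriv a) R + β * R * deriv a R + (((j : ℝ) + 1) * ((j : ℝ) + 2) + σ) * a R with hb₁
  set b₂ : ℝ → ℝ := fun R => -((j : ℝ) * ((j : ℝ) - 1)) * a R with hb₂
  have cb₁ : Continuous b₁ := by simp only [hb₁]; fun_prop
  have cb₂ : Continuous b₂ := by simp only [hb₂]; fun_prop
  have sa' : tsupport (deriv a) ⊆ tsupport a := tsupport_deriv_subset
  have sa'' : tsupport (deriv (deriv a)) ⊆ tsupport a := tsupport_deriv_subset.trans sa'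
  have sb₁ : HasCompactSupport b₁ := by
    refine HasCompactSupport.of_support_subset_isCompact has.isCompact fun R hR => ?_
    by_contra h
    apply hR
    simp only [hb₁, image_eq_zero_of_notMem_tsupport h, image_eq_zero_of_notMem_tsupport fun h' => h (sa' h'),
      image_eq_zero_of_notMem_tsupport fun h' => h (sa'' h')]; ring
  have sb₂ : HasCompactSupport b₂ := by simp only [hb₂]; exact has.mul_left
  obtain ⟨C₁, hC₁, hz₁⟩ := test_bounds cb₁ sb₁
  obtain ⟨C₂, hC₂, hz₂⟩ := test_bounds cb₂ sb₂
  have i₁ := integrableOn_mul_sep hDm hD2 cb₁.measurable (measurable_monomial q j) sb₁.isCompact hz₁ hC₁ (abs_monomial_le_one q j)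
  have i₂ := integrableOn_mul_sep hDm hD2 cb₂.measurable (measurable_monomial q (j - 2)) sb₂.isCompact hz₂ hC₂ (abs_monomial_le_one q (j - 2))
  have f₁ := integral_strip_mul_sep hDm hD2 cb₁.measurable (measurable_monomial q j) sb₁.isCompact hz₁ hC₁ (abs_monomial_le_one q j)
  have f₂ := integral_strip_mul_sep hDm hD2 cb₂.measurable (measurable_monomial q (j - 2)) sb₂.isCompact hz₂ hC₂ (abs_monomial_le_one q (j - 2))
  -- rewrite the hypothesis as the sum of the two separated integrals
  have hsplit : (∫ p in strip, D p * (b₁ p.1 * (Real.cos p.2 ^ q * Real.sin p.2 ^ j))) + ∫ p in strip, D p * (b₂ p.1 * (Real.cos p.2 ^ q * Real.sin p.2 ^ (j - 2))) = 0 := by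
    rw [← integral_add i₁ i₂, ← h]
    refine integral_congr_ae (ae_of_all _ fun p => ?_)
    simp only [hb₁, hb₂]; ring
  rw [f₁, f₂] at hsplit
  have e₂ : ∫ R in Ioi (0:ℝ), b₂ R * ∫ θ in Ioo 0 (π / 2), D (R, θ) * (Real.cos θ ^ q * Real.sin θ ^ (j - 2)) =
      -((j : ℝ) * ((j : ℝ) - 1)) * ∫ R in Ioi (0:ℝ), a R * ∫ θ in Ioo 0 (π / 2), D (R, θ) * (Real.cos θ ^ q * Real.sin θ ^ (j - 2)) := by
    rw [← MeasureTheory.integral_const_mul]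
    exact integral_congr_ae (ae_of_all _ fun R => by simp only [hb₂]; ring)
  rw [e₂] at hsplit
  have e₁ : ∫ R in Ioi (0:ℝ), (∫ θ in Ioo 0 (π / 2), D (R, θ) * (Real.cos θ ^ q * Real.sin θ ^ j)) * b₁ R =
      ∫ R in Ioi (0:ℝ), b₁ R * ∫ θ in Ioo 0 (π / 2), D (R, θ) * (Real.cos θ ^ q * Real.sin θ ^ j) :=
    integral_congr_ae (ae_of_all _ fun R => by ring)
  rw [e₁]
  linarith

/-! ### All odd moments vanish -/

/-- **The odd radial moments vanish a.e. on `(0,∞)`** (triangular induction over `j = 2k+1`: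
`L²` very weak solutions of the homogeneous Euler equations vanish). [cite: Elgindi2021, §7.1 Proposition 7.1 "the unique L² solution" (p. 19 of arXiv:1904.04795)] -/
theorem moment_ae_eq_zero {α β σ : ℝ} (hα : 0 < α)
    (H : ∀ j : ℕ, Odd j → ∀ a : ℝ → ℝ, ContDiff ℝ ∞ a → HasCompactSupport a → tsupport a ⊆ Ioi 0 →
      ∫ p in strip, D p * ((-α ^ 2 * p.1 ^ 2 * deriv (deriv a) p.1 + β * p.1 * deriv a p.1) * (Real.cos p.2 ^ q * Real.sin p.2 ^ j) +
        a p.1 * ((((j : ℝ) + 1) * ((j : ℝ) + 2) + σ) * (Real.cos p.2 ^ q * Real.sin p.2 ^ j) -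
          (j : ℝ) * ((j : ℝ) - 1) * (Real.cos p.2 ^ q * Real.sin p.2 ^ (j - 2)))) = 0) (k : ℕ) :
    ∀ᵐ R ∂(volume : Measure ℝ), R ∈ Ioi 0 → (∫ θ in Ioo 0 (π / 2), D (R, θ) * (Real.cos θ ^ q * Real.sin θ ^ (2 * k + 1))) = 0 := by
  induction k with
  | zero =>
    refine radialMode_ae_eq_zero hα β (((1 : ℝ) + 1) * ((1 : ℝ) + 2) + σ) (locallyIntegrableOn_moment hDm hD2 q 1) (fun a ha has haS => ?_)
      (integrableOn_sq_moment hDm hD2 q 1)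
    have h := moment_radial_identity hDm hD2 q 1 (H 1 odd_one) ha has haS
    simp only [Nat.cast_one, sub_self, mul_zero, zero_mul] at h
    simpa using h
  | succ k ih =>
    have hodd : Odd (2 * (k + 1) + 1) := ⟨k + 1, rfl⟩
    refine radialMode_ae_eq_zero hα β ((((2 * (k + 1) + 1 : ℕ) : ℝ) + 1) * (((2 * (k + 1) + 1 : ℕ) : ℝ) + 2) + σ)
      (locallyIntegrableOn_moment hDm hD2 q _) (fun a ha has haS => ?_) (integrableOn_sq_moment hDm hD2 q _)
    have h := moment_radial_identity hDm hD2 q (2 * (k + 1) + 1) (H _ hodd) ha has haS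
    -- the lower moment vanishes a.e., so the right-hand side is zero
    have hj2 : 2 * (k + 1) + 1 - 2 = 2 * k + 1 := by omega
    rw [hj2] at h
    have hzero : ∫ R in Ioi (0:ℝ), a R * ∫ θ in Ioo 0 (π / 2), D (R, θ) * (Real.cos θ ^ q * Real.sin θ ^ (2 * k + 1)) = 0 := by
      refine setIntegral_eq_zero_of_ae_eq_zero ?_
      filter_upwards [ih] with R hR hR0
      rw [hR hR0, mul_zero]
    rw [hzero, mul_zero] at h
    exact h

/-- **Uniqueness of square-integrable very weak solutions**: a measurable `D ∈ L²(strip)` which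
annihilates `L(a(R)cos θ sinʲθ)` for all odd `j` and all test functions `a` of `(0,∞)` vanishes
a.e. on the strip. [cite: Elgindi2021, §7.1 Proposition 7.1 "the unique L² solution" (p. 19 of arXiv:1904.04795)] -/
theorem ae_eq_zero_of_veryWeak_modes {α β σ : ℝ} (hα : 0 < α) (hq : 1 ≤ q)
    (H : ∀ j : ℕ, Odd j → ∀ a : ℝ → ℝ, ContDiff ℝ ∞ a → HasCompactSupport a → tsupport a ⊆ Ioi 0 →
      ∫ p in strip, D p * ((-α ^ 2 * p.1 ^ 2 * deriv (deriv a) p.1 + β * p.1 * deriv a p.1) * (Real.cos p.2 ^ q * Real.sin p.2 ^ j) +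
        a p.1 * ((((j : ℝ) + 1) * ((j : ℝ) + 2) + σ) * (Real.cos p.2 ^ q * Real.sin p.2 ^ j) -
          (j : ℝ) * ((j : ℝ) - 1) * (Real.cos p.2 ^ q * Real.sin p.2 ^ (j - 2)))) = 0) :
    D =ᵐ[volume.restrict strip] 0 := by
  -- for a.e. `R > 0`: all odd moments vanish and the slice is integrable
  have hall : ∀ᵐ R ∂(volume : Measure ℝ), R ∈ Ioi 0 → ∀ k : ℕ,
      (∫ θ in Ioo 0 (π / 2), D (R, θ) * (Real.cos θ ^ q * Real.sin θ ^ (2 * k + 1))) = 0 := by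
    have := ae_all_iff.2 fun k => moment_ae_eq_zero hDm hD2 q hα H k
    filter_upwards [this] with R hR hR0 k using hR k hR0
  have hD2' : Integrable (fun p : ℝ × ℝ => D p ^ 2) (((volume : Measure ℝ).restrict (Ioi 0)).prod (volume.restrict (Ioo 0 (π / 2)))) := by
    rw [← volume_restrict_strip_eq_prod]; exact hD2
  have hslice := hD2'.prod_right_ae
  have hall' : ∀ᵐ R ∂(volume.restrict (Ioi (0:ℝ))), ∀ k : ℕ,
      (∫ θ in Ioo 0 (π / 2), D (R, θ) * (Real.cos θ ^ q * Real.sin θ ^ (2 * k + 1))) = 0 :=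
    (ae_restrict_iff' measurableSet_Ioi).2 hall
  -- slice-wise conclusion
  have hsl : ∀ᵐ R ∂(volume.restrict (Ioi (0:ℝ))), ∀ᵐ θ ∂(volume.restrict (Ioo (0:ℝ) (π / 2))), D (R, θ) = 0 := by
    filter_upwards [hall', hslice] with R hR hR2
    have hmeasR : AEStronglyMeasurable (fun θ => D (R, θ)) (volume.restrict (Ioo 0 (π / 2))) :=
      (hDm.measurable.comp (measurable_const.prodMk measurable_id)).aestronglyMeasurable
    haveI : IsFiniteMeasure (volume.restrict (Ioo (0:ℝ) (π / 2))) := by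
      refine isFiniteMeasure_restrict.2 ?_; simp [Real.volume_Ioo]
    have hint : IntegrableOn (fun θ => D (R, θ)) (Ioo 0 (π / 2)) :=
      ((memLp_two_iff_integrable_sq hmeasR).2 hR2).integrable one_le_two
    -- `g = D(R,·) cos^{q-1}` has vanishing odd moments
    have hg : IntegrableOn (fun θ => D (R, θ) * Real.cos θ ^ (q - 1)) (Ioo 0 (π / 2)) :=
      integrableOn_continuous_mul hint (by fun_prop)
    have hgm : ∀ k : ℕ, ∫ θ in Ioo 0 (π / 2), D (R, θ) * Real.cos θ ^ (q - 1) * (Real.cos θ * Real.sin θ ^ (2 * k + 1)) = 0 := by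
      intro k
      refine Eq.trans (integral_congr_ae (ae_of_all _ fun θ => ?_)) (hR k)
      show D (R, θ) * Real.cos θ ^ (q - 1) * (Real.cos θ * Real.sin θ ^ (2 * k + 1)) = D (R, θ) * (Real.cos θ ^ q * Real.sin θ ^ (2 * k + 1))
      have : Real.cos θ ^ q = Real.cos θ ^ (q - 1) * Real.cos θ := by
        rw [← pow_succ]; congr 1; omega
      rw [this]; ring
    have h := ae_eq_zero_of_forall_oddMoment_eq_zero hg hgm
    have hmem : ∀ᵐ θ ∂(volume.restrict (Ioo (0:ℝ) (π / 2))), θ ∈ Ioo (0:ℝ) (π / 2) := ae_restrict_mem measurableSet_Ioo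
    filter_upwards [h, hmem] with θ hθ hθm
    have hc : Real.cos θ ≠ 0 := (Real.cos_pos_of_mem_Ioo ⟨by linarith [hθm.1, Real.pi_pos], hθm.2⟩).ne'
    have : D (R, θ) * Real.cos θ ^ (q - 1) = 0 := hθ
    rcases mul_eq_zero.1 this with h0 | h0
    · exact h0
    · exact absurd h0 (pow_ne_zero _ hc)
  -- assemble with Fubini for null sets
  have hmeas : MeasurableSet {p : ℝ × ℝ | D p = 0} := hDm.measurable (measurableSet_singleton 0)
  have hprod : ∀ᵐ p ∂(((volume : Measure ℝ).restrict (Ioi 0)).prod (volume.restrict (Ioo 0 (π / 2)))), p ∈ {p : ℝ × ℝ | D p = 0} :=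
    (Measure.ae_prod_mem_iff_ae_ae_mem hmeas).2 hsl
  rw [← volume_restrict_strip_eq_prod] at hprod
  exact hprod

end moments2

end Elgindi

end Literature.Analysis.FluidPDE
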